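import Summits.QuantumFields.YangMills.Theorems.ColdStartUniversalityLatticeLangevinHypercontractivityDini
import HarnessLib

/-!
# Route `ColdStartUniversality` (fixed-cut-off package, `Lᵖ` side): ★★★ GROSS'S THEOREM for the SZZ semigroup —
# LOG-SOBOLEV ⇒ HYPERCONTRACTIVITY `‖κ_t F‖_{q(t)} ≤ ‖F‖_p`, `q(t) = 1 + (p−1)e^{4ρt}`, at EVERY `(L, β')`

Helper file (seat `ym-line-csu-p1`, g36; `--supports stmt-QuantumFields-24809`).  SU(2) lattice Langevin dynamics of Shen–Zhu–Zhu at
`(L, β')`, Wilson measure `μ = μ_{β'}`, ANY realising kernel family `κ` (`κ_t F(x) = E F(U^x_t)`, reversible w.r.t. `μ`).  HYPOTHESIS: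
the generator-form log-Sobolev inequality `ρ·Ent_μ(F²) ≤ −∫ F·𝓛f dμ` on `C³` cylinders (`ρ ≥ 0`; DISCHARGED in the tree at every
`(L, β')` with `ρ = ½e^{−4|β'|#𝒫}` by `wilson_generatorLogSobolev_explicit`, and volume-uniformly with `ρ = (1 − 12|β'|)/2` for
`|β'| < 1/12` by `wilson_generatorLogSobolev_uniform`).  CONCLUSION (Gross 1975; Diaconis–Saloff-Coste Thm 3.5 (ii) for finite
chains is the tree's `Literature.Probability.MarkovChains.Saloffcoste1997_thm_2_2_4_reversible`): for every POSITIVE `C³` compactly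
supported cylinder `F = f∘coords`, every `1 < p` and every `t ≥ 0`,

  `‖κ_t F‖_{L^{q(t)}(μ)} ≤ ‖F‖_{L^p(μ)}`,   `q(t) = 1 + (p − 1)·e^{4ρt}`.

Route (no core, no differentiability of `t ↦ ‖κ_tF‖_{q(t)}`): `φ(t) = log ∫ (κ_tF)^{q(t)} dμ / q(t)` is continuous (joint
continuity of the kernel action, parametric integrals over a compact space) and its upper-right Dini derivative is `≤ 0`
(`lqNorm_log_transition_slope_lt_of_generatorLogSobolev`): one lattice step `h` is controlled by the scale-`h` `L^q` PRODUCTION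
inequality (`integral_rpow_transition_sub_le_dirichletScale`, Stroock–Varopoulos), the semigroup-form log-Sobolev inequality at
`(κ_tF)^{q/2}` (`semigroupLogSobolev_of_generatorLogSobolev`, `dirichletScale_antitone`), the exponent change
`q(t+h) − q(t) = (q−1)(e^{4ρh} − 1)` (`LqFlow.integral_rpow_add_le`) and the cancellation `q'·Ent = 4ρ(q−1)·Ent` (`LqFlow.gross_slope_lt`);
fencing by `image_le_of_liminf_slope_right_le_deriv_boundary`.
* (the Dini step `lqNorm_log_transition_slope_lt_of_generatorLogSobolev` is the prequel `…HypercontractivityDini`);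
* ★★★ `log_lqNorm_transition_le_of_generatorLogSobolev` — `log‖κ_tF‖_{q(t)} ≤ log‖F‖_p`;
* ★★★ `lqNorm_transition_le_of_generatorLogSobolev` — `(∫ (κ_tF)^{q(t)} dμ)^{1/q(t)} ≤ (∫ F^p dμ)^{1/p}`.
The extension to all bounded measurable `F` and the explicit constants are the sequel (`…HypercontractivityExplicit`).

THEOREMS ONLY, no definition, no sorry.  HONEST FRAMING: RECORD-rung R3 plumbing at FIXED cut-off; the log-Sobolev constant is the
HYPOTHESIS and, where discharged, degenerates with the cut-off (`½e^{−12|β'|L³}`) outside the high-temperature window; nothing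
K-uniform is proved; no crux, rung or summit statement is proved; the Yang–Mills mass gap is NOT proved.
-/

set_option autoImplicit false

noncomputable section

namespace Summit.QuantumFields.YangMills.Theorems.ColdStartUniversality

open MeasureTheory ProbabilityTheory Filter Set Topology
open scoped BigOperators NNReal ENNReal
open Literature.Probability.Process Literature.MathematicalPhysics.QuantumFieldTheory
open Literature.MathematicalPhysics.QuantumLattice (fundamentalRep fundamentalLatticeRep continuous_fundamentalRep)

variable {L : ℕ} [NeZero L]

/-! ## §2. Gross's theorem for positive `C³` cylinders -/

/-- ★★★ **Gross's theorem (log-Sobolev ⇒ hypercontractivity), logarithmic form.**  Under the generator-form log-Sobolev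
inequality with constant `ρ ≥ 0`, for every `C³` compactly supported `f` with `F = f∘coords > 0`, every `1 < p`, every realising
kernel family and every `t ≥ 0`:

  `log(∫ (κ_t F)^{q(t)} dμ_{β'})/q(t) ≤ log(∫ F^p dμ_{β'})/p`,   `q(t) = 1 + (p − 1)e^{4ρt}`,

i.e. `log ‖κ_tF‖_{q(t)} ≤ log ‖F‖_p`: `t ↦ log‖κ_tF‖_{q(t)}` is continuous with non-positive upper-right Dini derivative
(`lqNorm_log_transition_slope_lt_of_generatorLogSobolev`), fenced by `image_le_of_liminf_slope_right_le_deriv_boundary`.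
[cite: DiaconisSaloffcoste1996, Theorem 3.5 (ii)] -/
theorem log_lqNorm_transition_le_of_generatorLogSobolev (L : ℕ) [NeZero L] (β' : ℝ)
    (κ : ℝ≥0 → Kernel (GaugeConfig 3 L (Matrix.specialUnitaryGroup (Fin 2) ℂ))
      (GaugeConfig 3 L (Matrix.specialUnitaryGroup (Fin 2) ℂ))) [∀ t, IsMarkovKernel (κ t)]
    (hreal : ∀ (t : ℝ≥0) (x : GaugeConfig 3 L (Matrix.specialUnitaryGroup (Fin 2) ℂ))
        (Ω : Type) [MeasurableSpace Ω] (P : Measure Ω) [IsProbabilityMeasure P]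
        (W : ℝ≥0 → Ω → (Edge 3 L × NoiseIdx 2 → ℝ)) (hW : IsFlatBrownian W P)
        (U : ℝ≥0 → Ω → GaugeConfig 3 L (Matrix.specialUnitaryGroup (Fin 2) ℂ)),
        (∀ ω, U 0 ω = x) →
        (latticeLangevinDynamics (fundamentalLatticeRep 2) β').IsSolution (fundamentalRep (Fin 2))
          hW.natFiltration P W U →
        κ t x = P.map (U t))
    {ρ : ℝ} (hρ : 0 ≤ ρ)
    (hLSgen : ∀ (f : (Edge 3 L × Fin 2 × Fin 2 × Bool → ℝ) → ℝ), ContDiff ℝ 3 f →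
        let coords : GaugeConfig 3 L (Matrix.specialUnitaryGroup (Fin 2) ℂ) → (Edge 3 L × Fin 2 × Fin 2 × Bool → ℝ) :=
          fun V q => (fun z : ℂ => if q.2.2.2 then z.im else z.re)
            ((fundamentalRep (Fin 2) (V q.1) : Matrix (Fin 2) (Fin 2) ℂ) q.2.1 q.2.2.1)
        let gen : GaugeConfig 3 L (Matrix.specialUnitaryGroup (Fin 2) ℂ) → ℝ := fun V =>
          (∑ i : Edge 3 L × Fin 2 × Fin 2 × Bool, fderiv ℝ f (coords V) (Pi.single i 1) *
              (fun z : ℂ => if i.2.2.2 then z.im else z.re)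
                ((latticeLangevinDynamics (fundamentalLatticeRep 2) β').drift
                  (matrixConfig (fundamentalRep (Fin 2)) V) i.1 i.2.1 i.2.2.1) +
          1 / 2 * ∑ i : Edge 3 L × Fin 2 × Fin 2 × Bool, ∑ j : Edge 3 L × Fin 2 × Fin 2 × Bool,
            fderiv ℝ (fun z => fderiv ℝ f z (Pi.single i 1)) (coords V) (Pi.single j 1) *
              ∑ n : Edge 3 L × NoiseIdx 2,
                (if n.1 = i.1 then (fun z : ℂ => if i.2.2.2 then z.im else z.re)
                  ((latticeLangevinDynamics (fundamentalLatticeRep 2) β').noise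
                    (matrixConfig (fundamentalRep (Fin 2)) V) i.1 n.2 i.2.1 i.2.2.1) else 0) *
                (if n.1 = j.1 then (fun z : ℂ => if j.2.2.2 then z.im else z.re)
                  ((latticeLangevinDynamics (fundamentalLatticeRep 2) β').noise
                    (matrixConfig (fundamentalRep (Fin 2)) V) j.1 n.2 j.2.1 j.2.2.1) else 0))
        ρ * ((∫ V, f (coords V) ^ 2 * Real.log (f (coords V) ^ 2) ∂(wilsonMeasure (d := 3) (L := L) (fundamentalRep (Fin 2)) β')) -
            (∫ V, f (coords V) ^ 2 ∂(wilsonMeasure (d := 3) (L := L) (fundamentalRep (Fin 2)) β')) *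
              Real.log (∫ V, f (coords V) ^ 2 ∂(wilsonMeasure (d := 3) (L := L) (fundamentalRep (Fin 2)) β'))) ≤
          -∫ V, f (coords V) * gen V ∂(wilsonMeasure (d := 3) (L := L) (fundamentalRep (Fin 2)) β'))
    {f : (Edge 3 L × Fin 2 × Fin 2 × Bool → ℝ) → ℝ} (hf : ContDiff ℝ 3 f) (hfc : HasCompactSupport f)
    (hpos : ∀ x : GaugeConfig 3 L (Matrix.specialUnitaryGroup (Fin 2) ℂ),
      0 < f (fun q => (fun z : ℂ => if q.2.2.2 then z.im else z.re)
        ((fundamentalRep (Fin 2) (x q.1) : Matrix (Fin 2) (Fin 2) ℂ) q.2.1 q.2.2.1)))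
    {p : ℝ} (hp : 1 < p) (t : ℝ≥0) :
    let F : GaugeConfig 3 L (Matrix.specialUnitaryGroup (Fin 2) ℂ) → ℝ := fun x =>
      f (fun q => (fun z : ℂ => if q.2.2.2 then z.im else z.re)
        ((fundamentalRep (Fin 2) (x q.1) : Matrix (Fin 2) (Fin 2) ℂ) q.2.1 q.2.2.1))
    Real.log (∫ x, (∫ y, F y ∂(κ t x)) ^ (1 + (p - 1) * Real.exp (4 * ρ * t))
        ∂(wilsonMeasure (d := 3) (L := L) (fundamentalRep (Fin 2)) β')) / (1 + (p - 1) * Real.exp (4 * ρ * t)) ≤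
      Real.log (∫ x, F x ^ p ∂(wilsonMeasure (d := 3) (L := L) (fundamentalRep (Fin 2)) β')) / p := by
  intro F
  classical
  haveI := secondCountableTopology_su2
  haveI := borelSpace_config L
  set μ : Measure (GaugeConfig 3 L (Matrix.specialUnitaryGroup (Fin 2) ℂ)) :=
    wilsonMeasure (d := 3) (L := L) (fundamentalRep (Fin 2)) β' with hμ
  haveI : IsProbabilityMeasure μ :=
    isProbabilityMeasure_wilsonMeasure (d := 3) (L := L) (fundamentalRep (Fin 2)) (continuous_fundamentalRep (Fin 2)) β'
  have hFc : Continuous F := hf.continuous.comp (continuous_coords (L := L))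
  obtain ⟨δ, hδ, hδF⟩ := exists_pos_le_of_continuous_of_compactSpace hFc hpos
  -- `u s = κ_s F`
  set u : ℝ≥0 → GaugeConfig 3 L (Matrix.specialUnitaryGroup (Fin 2) ℂ) → ℝ := fun s x => ∫ y, F y ∂(κ s x) with hu
  have huc : ∀ s, Continuous (u s) := fun s => continuous_integral_transitionKernel L β' κ hreal s hFc
  have huδ : ∀ s x, δ ≤ u s x := by
    intro s x
    have := integral_mono (integrable_const (μ := κ s x) δ) (integrable_of_continuous_of_compactSpace hFc _) fun y => hδF y
    rwa [integral_const, probReal_univ, one_smul] at this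
  have hupos : ∀ s x, 0 < u s x := fun s x => lt_of_lt_of_le hδ (huδ s x)
  -- Chapman–Kolmogorov and the Dynkin Lipschitz bound
  have hCK : ∀ (s h : ℝ≥0) x, ∫ y, u s y ∂(κ h x) = u (s + h) x := fun s h x =>
    transition_transition_cylinder_eq L β' κ hreal hFc s h x
  obtain ⟨C, -, hLip⟩ := exists_abs_transition_cylinder_sub_le L β' κ hreal hf hfc
  have hLip' : ∀ (s h : ℝ≥0) x, |u (s + h) x - u s x| ≤ C * h := fun s h x => hLip s h x
  -- the moving exponent and the function `φ`
  set qf : ℝ → ℝ := fun s => 1 + (p - 1) * Real.exp (4 * ρ * s) with hqf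
  have hqf1 : ∀ s, 1 < qf s := fun s => by
    have : 0 < (p - 1) * Real.exp (4 * ρ * s) := mul_pos (by linarith) (Real.exp_pos _)
    simp only [hqf]; linarith
  have hqfc : Continuous qf := by simp only [hqf]; fun_prop
  set Nf : ℝ → ℝ := fun s => ∫ x, (u s.toNNReal x) ^ (qf s) ∂μ with hNf
  have hNfpos : ∀ s, 0 < Nf s := by
    intro s
    have hc : Continuous fun x => (u s.toNNReal x) ^ (qf s) := (huc _).rpow_const fun x => Or.inl (hupos _ x).ne'
    have h1 : δ ^ (qf s) ≤ Nf s := by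
      have := integral_mono (integrable_const (δ ^ (qf s))) (integrable_of_continuous_of_compactSpace hc μ)
        fun x => Real.rpow_le_rpow hδ.le (huδ _ x) (by linarith [hqf1 s])
      rwa [integral_const, probReal_univ, one_smul] at this
    exact lt_of_lt_of_le (Real.rpow_pos_of_pos hδ _) h1
  set φ : ℝ → ℝ := fun s => Real.log (Nf s) / qf s with hφ
  -- (a) `φ` is continuous: joint continuity of `(s, x) ↦ u_s(x)^{q(s)}` and parametric integrals over the compact space
  have hφc : Continuous φ := by
    have hjc : Continuous (Function.uncurry fun (s : ℝ) (x : GaugeConfig 3 L (Matrix.specialUnitaryGroup (Fin 2) ℂ)) =>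
        u s.toNNReal x) :=
      (continuous_transitionKernel_action β' κ hreal hFc).comp
        ((continuous_real_toNNReal.comp continuous_fst).prodMk continuous_snd)
    have hW : Continuous (Function.uncurry fun (s : ℝ) (x : GaugeConfig 3 L (Matrix.specialUnitaryGroup (Fin 2) ℂ)) =>
        (u s.toNNReal x) ^ (qf s)) := by
      have h1 : Continuous fun p : ℝ × GaugeConfig 3 L (Matrix.specialUnitaryGroup (Fin 2) ℂ) =>
          (u p.1.toNNReal p.2) ^ (qf p.1) :=
        hjc.rpow (hqfc.comp continuous_fst) fun p => Or.inl (hupos _ _).ne'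
      exact h1
    have hNc : Continuous Nf := by
      have h := continuous_parametric_integral_of_continuous (μ := μ) hW isCompact_univ
      simpa [Measure.restrict_univ, hNf] using h
    exact (hNc.log fun s => (hNfpos s).ne').div hqfc fun s => by linarith [hqf1 s]
  -- (b) the Dini estimate
  have hD : ∀ s : ℝ, 0 ≤ s → ∀ r : ℝ, 0 < r → ∃ᶠ z in 𝓝[>] s, slope φ s z < r := by
    intro s hs r hr
    have hCs : ∀ (h : ℝ≥0) x, |(∫ y, u s.toNNReal y ∂(κ h x)) - u s.toNNReal x| ≤ C * h := by
      intro h x; rw [hCK]; exact hLip' _ _ x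
    obtain ⟨hstar, hhstar, hwin⟩ := lqNorm_log_transition_slope_lt_of_generatorLogSobolev L β' κ hreal hρ hLSgen (huc _)
      hδ (huδ _) hCs (hqf1 s) hr
    have hev : ∀ᶠ z in 𝓝[>] s, slope φ s z < r := by
      filter_upwards [Ioo_mem_nhdsGT (show s < s + hstar by linarith)] with z hz
      obtain ⟨hzs, hzs'⟩ := hz
      have hh0 : 0 < z - s := by linarith
      have hhlt : z - s < hstar := by linarith
      have hhpos' : 0 < (z - s).toNNReal := Real.toNNReal_pos.2 hh0
      have hcoe : (((z - s).toNNReal : ℝ≥0) : ℝ) = z - s := Real.coe_toNNReal _ hh0.le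
      have ez : z.toNNReal = s.toNNReal + (z - s).toNNReal := by
        rw [← Real.toNNReal_add hs hh0.le]; congr 1; ring
      have hw := hwin (z - s).toNNReal hhpos' (by rw [hcoe]; exact hhlt)
      -- identify `κ_h u_s = u_z` and `1 + (q(s) − 1)e^{4ρh} = q(z)`
      simp_rw [hCK] at hw
      rw [← ez, hcoe, ← hμ] at hw
      have eq1 : 1 + (qf s - 1) * Real.exp (4 * ρ * (z - s)) = qf z := by
        simp only [hqf]
        have : Real.exp (4 * ρ * s) * Real.exp (4 * ρ * (z - s)) = Real.exp (4 * ρ * z) := by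
          rw [← Real.exp_add]; congr 1; ring
        calc 1 + (1 + (p - 1) * Real.exp (4 * ρ * s) - 1) * Real.exp (4 * ρ * (z - s))
            = 1 + (p - 1) * (Real.exp (4 * ρ * s) * Real.exp (4 * ρ * (z - s))) := by ring
          _ = 1 + (p - 1) * Real.exp (4 * ρ * z) := by rw [this]
      rw [eq1] at hw
      rw [slope_def_field, div_lt_iff₀ hh0]
      have eφz : φ z = Real.log (Nf z) / qf z := rfl
      have eφs : φ s = Real.log (Nf s) / qf s := rfl
      rw [eφz, eφs]
      linarith
    exact hev.frequently
  -- (c) fencing: `φ t ≤ φ 0`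
  have hle := image_le_of_liminf_slope_right_le_deriv_boundary (f := φ) (a := 0) (b := t) hφc.continuousOn
    (B := fun _ => φ 0) (B' := fun _ => 0) le_rfl continuousOn_const
    (fun x _ => (hasDerivAt_const x (φ 0)).hasDerivWithinAt) (fun x hx r hr => hD x hx.1 r hr) (x := t) ⟨t.2, le_rfl⟩
  -- (d) read off `φ t` and `φ 0`
  have eφt : φ t = Real.log (∫ x, (∫ y, F y ∂(κ t x)) ^ (1 + (p - 1) * Real.exp (4 * ρ * t)) ∂μ) /
      (1 + (p - 1) * Real.exp (4 * ρ * t)) := by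
    simp only [hφ, hNf, hqf, hu, Real.toNNReal_coe]
  have eφ0 : φ 0 = Real.log (∫ x, F x ^ p ∂μ) / p := by
    have hκ0 : κ 0 = Kernel.id := transitionKernel_zero_eq_id L β' κ hreal
    have e1 : qf 0 = p := by simp only [hqf]; simp
    simp only [hφ, hNf, e1, hu, Real.toNNReal_zero, hκ0, Kernel.id_apply, integral_dirac]
  rw [eφt, eφ0] at hle
  exact hle

/-- ★★★ **Gross's theorem (log-Sobolev ⇒ hypercontractivity), norm form.**  Under the generator-form log-Sobolev inequality with
constant `ρ ≥ 0`, for every `C³` compactly supported `f` with `F = f∘coords > 0`, every `1 < p`, every realising kernel family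
and every `t ≥ 0`:

  `(∫ (κ_t F)^{q(t)} dμ_{β'})^{1/q(t)} ≤ (∫ F^p dμ_{β'})^{1/p}`,   `q(t) = 1 + (p − 1)e^{4ρt}`,

i.e. `‖κ_t‖_{L^p(μ) → L^{q(t)}(μ)} ≤ 1` on positive smooth cylinders (hence, by density — sequel — on all of `L^p`).
[cite: DiaconisSaloffcoste1996, Theorem 3.5 (ii)] -/
theorem lqNorm_transition_le_of_generatorLogSobolev (L : ℕ) [NeZero L] (β' : ℝ)
    (κ : ℝ≥0 → Kernel (GaugeConfig 3 L (Matrix.specialUnitaryGroup (Fin 2) ℂ))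
      (GaugeConfig 3 L (Matrix.specialUnitaryGroup (Fin 2) ℂ))) [∀ t, IsMarkovKernel (κ t)]
    (hreal : ∀ (t : ℝ≥0) (x : GaugeConfig 3 L (Matrix.specialUnitaryGroup (Fin 2) ℂ))
        (Ω : Type) [MeasurableSpace Ω] (P : Measure Ω) [IsProbabilityMeasure P]
        (W : ℝ≥0 → Ω → (Edge 3 L × NoiseIdx 2 → ℝ)) (hW : IsFlatBrownian W P)
        (U : ℝ≥0 → Ω → GaugeConfig 3 L (Matrix.specialUnitaryGroup (Fin 2) ℂ)),
        (∀ ω, U 0 ω = x) →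
        (latticeLangevinDynamics (fundamentalLatticeRep 2) β').IsSolution (fundamentalRep (Fin 2))
          hW.natFiltration P W U →
        κ t x = P.map (U t))
    {ρ : ℝ} (hρ : 0 ≤ ρ)
    (hLSgen : ∀ (f : (Edge 3 L × Fin 2 × Fin 2 × Bool → ℝ) → ℝ), ContDiff ℝ 3 f →
        let coords : GaugeConfig 3 L (Matrix.specialUnitaryGroup (Fin 2) ℂ) → (Edge 3 L × Fin 2 × Fin 2 × Bool → ℝ) :=
          fun V q => (fun z : ℂ => if q.2.2.2 then z.im else z.re)
            ((fundamentalRep (Fin 2) (V q.1) : Matrix (Fin 2) (Fin 2) ℂ) q.2.1 q.2.2.1)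
        let gen : GaugeConfig 3 L (Matrix.specialUnitaryGroup (Fin 2) ℂ) → ℝ := fun V =>
          (∑ i : Edge 3 L × Fin 2 × Fin 2 × Bool, fderiv ℝ f (coords V) (Pi.single i 1) *
              (fun z : ℂ => if i.2.2.2 then z.im else z.re)
                ((latticeLangevinDynamics (fundamentalLatticeRep 2) β').drift
                  (matrixConfig (fundamentalRep (Fin 2)) V) i.1 i.2.1 i.2.2.1) +
          1 / 2 * ∑ i : Edge 3 L × Fin 2 × Fin 2 × Bool, ∑ j : Edge 3 L × Fin 2 × Fin 2 × Bool,
            fderiv ℝ (fun z => fderiv ℝ f z (Pi.single i 1)) (coords V) (Pi.single j 1) *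
              ∑ n : Edge 3 L × NoiseIdx 2,
                (if n.1 = i.1 then (fun z : ℂ => if i.2.2.2 then z.im else z.re)
                  ((latticeLangevinDynamics (fundamentalLatticeRep 2) β').noise
                    (matrixConfig (fundamentalRep (Fin 2)) V) i.1 n.2 i.2.1 i.2.2.1) else 0) *
                (if n.1 = j.1 then (fun z : ℂ => if j.2.2.2 then z.im else z.re)
                  ((latticeLangevinDynamics (fundamentalLatticeRep 2) β').noise
                    (matrixConfig (fundamentalRep (Fin 2)) V) j.1 n.2 j.2.1 j.2.2.1) else 0))
        ρ * ((∫ V, f (coords V) ^ 2 * Real.log (f (coords V) ^ 2) ∂(wilsonMeasure (d := 3) (L := L) (fundamentalRep (Fin 2)) β')) -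
            (∫ V, f (coords V) ^ 2 ∂(wilsonMeasure (d := 3) (L := L) (fundamentalRep (Fin 2)) β')) *
              Real.log (∫ V, f (coords V) ^ 2 ∂(wilsonMeasure (d := 3) (L := L) (fundamentalRep (Fin 2)) β'))) ≤
          -∫ V, f (coords V) * gen V ∂(wilsonMeasure (d := 3) (L := L) (fundamentalRep (Fin 2)) β'))
    {f : (Edge 3 L × Fin 2 × Fin 2 × Bool → ℝ) → ℝ} (hf : ContDiff ℝ 3 f) (hfc : HasCompactSupport f)
    (hpos : ∀ x : GaugeConfig 3 L (Matrix.specialUnitaryGroup (Fin 2) ℂ),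
      0 < f (fun q => (fun z : ℂ => if q.2.2.2 then z.im else z.re)
        ((fundamentalRep (Fin 2) (x q.1) : Matrix (Fin 2) (Fin 2) ℂ) q.2.1 q.2.2.1)))
    {p : ℝ} (hp : 1 < p) (t : ℝ≥0) :
    let F : GaugeConfig 3 L (Matrix.specialUnitaryGroup (Fin 2) ℂ) → ℝ := fun x =>
      f (fun q => (fun z : ℂ => if q.2.2.2 then z.im else z.re)
        ((fundamentalRep (Fin 2) (x q.1) : Matrix (Fin 2) (Fin 2) ℂ) q.2.1 q.2.2.1))
    (∫ x, (∫ y, F y ∂(κ t x)) ^ (1 + (p - 1) * Real.exp (4 * ρ * t))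
        ∂(wilsonMeasure (d := 3) (L := L) (fundamentalRep (Fin 2)) β')) ^ (1 / (1 + (p - 1) * Real.exp (4 * ρ * t))) ≤
      (∫ x, F x ^ p ∂(wilsonMeasure (d := 3) (L := L) (fundamentalRep (Fin 2)) β')) ^ (1 / p) := by
  intro F
  classical
  haveI := secondCountableTopology_su2
  haveI := borelSpace_config L
  set μ : Measure (GaugeConfig 3 L (Matrix.specialUnitaryGroup (Fin 2) ℂ)) :=
    wilsonMeasure (d := 3) (L := L) (fundamentalRep (Fin 2)) β' with hμ
  haveI : IsProbabilityMeasure μ :=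
    isProbabilityMeasure_wilsonMeasure (d := 3) (L := L) (fundamentalRep (Fin 2)) (continuous_fundamentalRep (Fin 2)) β'
  have hlog := log_lqNorm_transition_le_of_generatorLogSobolev L β' κ hreal hρ hLSgen hf hfc hpos hp t
  simp only [← hμ] at hlog
  have hFc : Continuous F := hf.continuous.comp (continuous_coords (L := L))
  obtain ⟨δ, hδ, hδF⟩ := exists_pos_le_of_continuous_of_compactSpace hFc hpos
  set q : ℝ := 1 + (p - 1) * Real.exp (4 * ρ * t) with hq
  have hq1 : 1 < q := by
    have : 0 < (p - 1) * Real.exp (4 * ρ * t) := mul_pos (by linarith) (Real.exp_pos _)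
    rw [hq]; linarith
  -- both integrals are positive
  have hvc : Continuous fun x => ∫ y, F y ∂(κ t x) := continuous_integral_transitionKernel L β' κ hreal t hFc
  have hvδ : ∀ x, δ ≤ ∫ y, F y ∂(κ t x) := by
    intro x
    have := integral_mono (integrable_const (μ := κ t x) δ) (integrable_of_continuous_of_compactSpace hFc _) fun y => hδF y
    rwa [integral_const, probReal_univ, one_smul] at this
  have hvpos : ∀ x, 0 < ∫ y, F y ∂(κ t x) := fun x => lt_of_lt_of_le hδ (hvδ x)
  have hN1 : 0 < ∫ x, (∫ y, F y ∂(κ t x)) ^ q ∂μ := by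
    have hc : Continuous fun x => (∫ y, F y ∂(κ t x)) ^ q := hvc.rpow_const fun x => Or.inl (hvpos x).ne'
    have h1 : δ ^ q ≤ ∫ x, (∫ y, F y ∂(κ t x)) ^ q ∂μ := by
      have := integral_mono (integrable_const (δ ^ q)) (integrable_of_continuous_of_compactSpace hc μ)
        fun x => Real.rpow_le_rpow hδ.le (hvδ x) (by linarith)
      rwa [integral_const, probReal_univ, one_smul] at this
    exact lt_of_lt_of_le (Real.rpow_pos_of_pos hδ _) h1
  have hN0 : 0 < ∫ x, F x ^ p ∂μ := by
    have hc : Continuous fun x => F x ^ p := hFc.rpow_const fun x => Or.inl (hpos x).ne'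
    have h1 : δ ^ p ≤ ∫ x, F x ^ p ∂μ := by
      have := integral_mono (integrable_const (δ ^ p)) (integrable_of_continuous_of_compactSpace hc μ)
        fun x => Real.rpow_le_rpow hδ.le (hδF x) (by linarith)
      rwa [integral_const, probReal_univ, one_smul] at this
    exact lt_of_lt_of_le (Real.rpow_pos_of_pos hδ _) h1
  rw [Real.rpow_def_of_pos hN1, Real.rpow_def_of_pos hN0, Real.exp_le_exp, mul_one_div, mul_one_div]
  exact hlog

end Summit.QuantumFields.YangMills.Theorems.ColdStartUniversality

end
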